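import Mathlib
import HarnessLib
import Summits.QuantumAdvantage.QuantumAdvantage.Theorems.PhaseParity

/-!
# The GAP LAW (part A of 2): fixed firing sets, window slices, the three parities along a gap

Cell `decomp-qadv`, lens 4 (minimal counterexample / extremal), generation 26, third node: the ZERO-ERROR
VISIT-PARITY ELIMINATION for gapped firing sets, and the structure theorem «a perfect low-degree level set fires
EVERYWHERE DENSELY».

SETTING (u-walk game, `AdviceFreeQNC0.WalkTransport`): board `(n, c)`, cuts `g ∈ {0, …, n}`, cut `g` is live at
`u ∈ {0,1}ⁿ` iff `c + g + |u| + W_g(u) ≢ 0 (mod 3)` (`W_g` = `wtPrefix`, the weight of the bits `< g`); a set of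
fired cuts WINS at `u` iff an odd number of them is live.  Here the fired set is a FIXED set `Y` (`liveCountY`,
`winY`) — the situation on a level set of a strategy reading finitely many features, where the fired set is constant
(`ringWinU_eq_winY`).

THE THREE PARITIES ALONG A GAP (`exists_even_class`).  Let `B = [a, a + ℓ)` be a window of bit positions that no
cut of `Y` separates: every `h ∈ Y` has `h ≤ a` or `h ≥ a + ℓ`.  Fix the bits outside `B` (`windowGlue a ℓ z ·`) and
let `b = |w| (mod 3)` be the weight class of the window bits `w`.  A cut `h ≤ a` does not see the window in its
prefix, so it is live iff `q_h + b ≢ 0`; a cut `h ≥ a + ℓ` sees all of it, so it is live iff `q_h + 2b ≢ 0`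
(`q_h` a constant of the slice; `live_windowGlue_iff`).  Either way `h` is dead for EXACTLY ONE of the three classes
`b`, so the three live counts `N(0), N(1), N(2)` sum to `2·#Y`: they are never all odd.  Hence in every slice a
whole weight class of the window consists of LOSSES of `Y`.

THE IMMUNITY STEP (Beck–Li 2013 Thm 5.2 = the tree's `eq_zero_of_lowDegOn_of_forall_dvd_hwt`, cited BY NAME;
= `PhaseParity.eq_zero_of_lowDeg_vanish_class`): a function of degree `≤ D` on `{0,1}^ℓ`, `3D + 2 ≤ ℓ`, vanishing on a weight
class mod `3` is zero (any field with `3 ≠ 0`).  Restriction to a slice keeps the degree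
(`WalkTransport.comp_mem_lowDeg_of_coord`, `comp_windowGlue_mem_lowDeg`).

THE GAP LAW (`gap_law`, any field with `3 ≠ 0`): if `f` has degree `≤ D`, the fixed set `Y` wins at every point
where `f ≠ 0`, and `Y` leaves a cut-free window of `ℓ ≥ 3D + 2` bits, then `f = 0`.  COROLLARIES: a perfect
strategy that fires the constant set `Y` on a non-empty level set `{P = 1}` of `𝔽_p`-degree `≤ D` (`p ≠ 3`) fires
DENSELY there — `Y` meets every window `(a, a + 3D + 2)` (`perfect_levelSet_dense`, `levelSet_false_of_perfect_gap`);
and a strategy supported on a set `S` of cuts leaving a cut-free window of `3·#S·d + 2` bits is not perfect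
(`exists_loss_of_sparse_window` — the perfect-strategy form of the cell's sparse rung, in ten lines).

WHAT THIS IS / IS NOT.  It is the zero-error form of the cell's visit-parity elimination (`FeatOfVPE`: the dense
core of the `𝔽_p` walk game) for GAPPED firing sets, unconditional and for every `p ≠ 3` at once (false at `p = 3`
only through the degree bound: `walkEasyThree` fires `{0}` or `{1}`, gapped, on level sets of degree `n/1`).  It does
NOT prove the residual `X = AbsorptionDial.NoPerfectPolyOdd`: a general low-degree strategy has no low-degree level
sets with constant fired set, and a level set whose fired set is `(3D+2)`-dense (consecutive fired cuts closer than
the immunity length) escapes the slicing — DENSE FIRING is the residual this node leaves (memo NODE-g26 §9).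
PART A (this file): §2 fixed firing sets (`liveCountY`, `winY`, `ringWinU_eq_winY`), §3 window slices (`windowGlue`,
`comp_windowGlue_mem_lowDeg`, the weight bookkeeping `wt_windowGlue`, `wtPrefix_windowGlue_of_le/_of_ge`), §4 the three parities
(`live_windowGlue_iff`, `exists_even_class`, `exists_losing_windowClass`).  Part B: the law and its corollaries.  Imports
`Theorems.PhaseParity` (immunity wrapper `eq_zero_of_lowDeg_vanish_class`, `three_ne_zero_zmod_of_ne`).  The two-sided separator windowGlue of
the cell (`OddConfig.glue`, `OddPrimeWalkOddConfig.lean`) and its end-register law (`OddPrimeWalkEndRegisterLawFive.lean`: the same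
«each table bit is counted an even number of times» step, positive-fraction, end-structured registers, `p = 5`) are the nearest tree
relatives; here the window is interior (three-part windowGlue), the outside firing set arbitrary, and the conclusion zero-error via immunity.
Theses-free; no `sorry`; no instances, no notation.
-/


set_option autoImplicit false
set_option linter.dupNamespace false

namespace Summit.QuantumAdvantage.QuantumAdvantage.Theorems.GapLaw
open Classical
open Finset
open Summit.QuantumAdvantage.AdviceFreeQNC0
open Summit.QuantumAdvantage.QuantumAdvantage.Theorems.PhaseParity
open Literature.Computability.MetaComplexity Literature.Computability.MetaComplexity.Smolensky

/-! ### §2 Fixed firing sets -/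

section Fixed

variable {n : ℕ}

/-- The number of LIVE cuts of the fixed firing set `Y` at the input `u` of the board with charge `c`. -/
def liveCountY (c : ℕ) (Y : Finset (Fin (n + 1))) (u : Fin n → Bool) : ℕ :=
  (Y.filter fun g => (c + g.val + walkExp u g.val) % 3 ≠ 0).card

/-- The fixed firing set `Y` WINS at `u` iff an odd number of its cuts is live. -/
def winY (c : ℕ) (Y : Finset (Fin (n + 1))) (u : Fin n → Bool) : Bool :=
  decide (liveCountY c Y u % 2 = 1)

/-- If the strategy `y` fires exactly the cuts of `Y` at `u`, its win bit is `winY c Y u`. -/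
theorem ringWinU_eq_winY (c : ℕ) (y : Fin (n + 1) → (Fin n → Bool) → Bool) (Y : Finset (Fin (n + 1)))
    (u : Fin n → Bool) (hY : ∀ g, y g u = true ↔ g ∈ Y) : ringWinU c y u = winY c Y u := by
  have hset : (univ.filter fun g : Fin (n + 1) =>
        y g u = true ∧ (c + g.val + walkExp u g.val) % 3 ≠ 0) =
      Y.filter fun g => (c + g.val + walkExp u g.val) % 3 ≠ 0 := by
    ext g
    simp only [mem_filter, mem_univ, true_and, hY g]
  unfold ringWinU winY liveCountY
  rw [hset]

end Fixed

/-! ### §3 Slices: a window of free bits glued into a fixed background -/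

section Glue

variable {n : ℕ}

/-- Glue the window bits `w ∈ {0,1}^ℓ` into positions `[a, a + ℓ)` of the background `z`. -/
def windowGlue (a ℓ : ℕ) (z : Fin n → Bool) (w : Fin ℓ → Bool) : Fin n → Bool :=
  fun i => if h : a ≤ i.val ∧ i.val < a + ℓ then w ⟨i.val - a, by omega⟩ else z i

/-- The window bits of an input. -/
def blockBits (a ℓ : ℕ) (ha : a + ℓ ≤ n) (u : Fin n → Bool) : Fin ℓ → Bool :=
  fun j => u ⟨a + j.val, by omega⟩

/-- Every input lies in its own slice. -/
theorem windowGlue_blockBits (a ℓ : ℕ) (ha : a + ℓ ≤ n) (u : Fin n → Bool) :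
    windowGlue a ℓ u (blockBits a ℓ ha u) = u := by
  funext i
  unfold windowGlue blockBits
  split
  · next h => exact congrArg u (Fin.ext (Nat.add_sub_cancel' h.1))
  · rfl

/-- Restriction to a slice keeps the degree (composition with a coordinate map, `comp_mem_lowDeg_of_coord`). -/
theorem comp_windowGlue_mem_lowDeg {F : Type*} [Field F] (a ℓ : ℕ) (z : Fin n → Bool) {D : ℕ} {f : CubeFn F n}
    (hf : f ∈ lowDeg F n D) : (fun w : Fin ℓ → Bool => f (windowGlue a ℓ z w)) ∈ lowDeg F ℓ D := by
  refine comp_mem_lowDeg_of_coord (windowGlue a ℓ z) (fun i => ?_) hf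
  by_cases h : a ≤ i.val ∧ i.val < a + ℓ
  · have heq : (fun w : Fin ℓ → Bool => if windowGlue a ℓ z w i = true then (1 : F) else 0) =
        mono F {(⟨i.val - a, by omega⟩ : Fin ℓ)} := by
      funext w
      simp only [windowGlue, dif_pos h, mono, Finset.prod_singleton]
    rw [heq]
    exact mono_mem_lowDeg (by simp)
  · by_cases hz : z i = true
    · have heq : (fun w : Fin ℓ → Bool => if windowGlue a ℓ z w i = true then (1 : F) else 0) = 1 := by
        funext w
        simp [windowGlue, h, hz]
      rw [heq]
      exact one_mem_lowDeg 1
    · have heq : (fun w : Fin ℓ → Bool => if windowGlue a ℓ z w i = true then (1 : F) else 0) = 0 := by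
        funext w
        simp [windowGlue, h, hz]
      rw [heq]
      exact Submodule.zero_mem _

/-- The weight of the background outside the window. -/
def outW (a ℓ : ℕ) (z : Fin n → Bool) : ℕ :=
  (univ.filter fun i : Fin n => z i = true ∧ ¬ (a ≤ i.val ∧ i.val < a + ℓ)).card

/-- The weight of the background outside the window and before position `h`. -/
def outP (a ℓ : ℕ) (z : Fin n → Bool) (h : ℕ) : ℕ :=
  (univ.filter fun i : Fin n => (i.val < h ∧ z i = true) ∧ ¬ (a ≤ i.val ∧ i.val < a + ℓ)).card

/-- Inside the window the glued input carries exactly the weight of the window bits. -/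
theorem card_windowGlue_window (a ℓ : ℕ) (ha : a + ℓ ≤ n) (z : Fin n → Bool) (w : Fin ℓ → Bool) :
    (univ.filter fun i : Fin n => windowGlue a ℓ z w i = true ∧ (a ≤ i.val ∧ i.val < a + ℓ)).card = wt w := by
  unfold wt
  refine Finset.card_bij' (fun i hi => (⟨i.val - a, by have := (mem_filter.1 hi).2.2; omega⟩ : Fin ℓ))
    (fun j _ => (⟨a + j.val, by omega⟩ : Fin n)) (fun i hi => ?_) (fun j hj => ?_) (fun i hi => ?_)
    (fun j hj => ?_)
  · have h := (mem_filter.1 hi).2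
    have hg : windowGlue a ℓ z w i = w ⟨i.val - a, by omega⟩ := by simp only [windowGlue, dif_pos h.2]
    simp only [mem_filter, mem_univ, true_and]
    rw [← hg]
    exact h.1
  · have h := (mem_filter.1 hj).2
    have hin : a ≤ (⟨a + j.val, by omega⟩ : Fin n).val ∧ (⟨a + j.val, by omega⟩ : Fin n).val < a + ℓ :=
      ⟨Nat.le_add_right a j.val, Nat.add_lt_add_left j.isLt a⟩
    simp only [mem_filter, mem_univ, true_and]
    refine ⟨?_, hin⟩
    simp only [windowGlue, dif_pos hin]
    have hj' : (⟨(⟨a + j.val, by omega⟩ : Fin n).val - a,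
        lt_of_eq_of_lt (Nat.add_sub_cancel_left a j.val) j.isLt⟩ : Fin ℓ) = j :=
      Fin.ext (Nat.add_sub_cancel_left a j.val)
    rw [hj']
    exact h
  · have h := (mem_filter.1 hi).2.2
    exact Fin.ext (Nat.add_sub_cancel' h.1)
  · exact Fin.ext (Nat.add_sub_cancel_left a j.val)

/-- Weight of a glued input = outside weight + window weight. -/
theorem wt_windowGlue (a ℓ : ℕ) (ha : a + ℓ ≤ n) (z : Fin n → Bool) (w : Fin ℓ → Bool) :
    wt (windowGlue a ℓ z w) = outW a ℓ z + wt w := by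
  have hsplit := Finset.card_filter_add_card_filter_not
    (s := univ.filter fun i : Fin n => windowGlue a ℓ z w i = true) (fun i : Fin n => a ≤ i.val ∧ i.val < a + ℓ)
  rw [Finset.filter_filter, Finset.filter_filter, card_windowGlue_window a ℓ ha z w] at hsplit
  have hout : (univ.filter fun i : Fin n => windowGlue a ℓ z w i = true ∧ ¬ (a ≤ i.val ∧ i.val < a + ℓ)) =
      univ.filter fun i : Fin n => z i = true ∧ ¬ (a ≤ i.val ∧ i.val < a + ℓ) := by
    refine Finset.filter_congr fun i _ => ?_
    constructor
    · rintro ⟨hg, hb⟩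
      simp only [windowGlue, dif_neg hb] at hg
      exact ⟨hg, hb⟩
    · rintro ⟨hz, hb⟩
      refine ⟨?_, hb⟩
      simp only [windowGlue, dif_neg hb]
      exact hz
  rw [hout] at hsplit
  unfold wt outW at *
  omega

/-- Prefix weight of a glued input at a cut `h ≤ a` (window entirely in the suffix): outside part only. -/
theorem wtPrefix_windowGlue_of_le (a ℓ : ℕ) (z : Fin n → Bool) (w : Fin ℓ → Bool) {h : ℕ}
    (hh : h ≤ a) : wtPrefix (windowGlue a ℓ z w) h = outP a ℓ z h := by
  have hsplit := Finset.card_filter_add_card_filter_not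
    (s := univ.filter fun i : Fin n => i.val < h ∧ windowGlue a ℓ z w i = true)
    (fun i : Fin n => a ≤ i.val ∧ i.val < a + ℓ)
  rw [Finset.filter_filter, Finset.filter_filter] at hsplit
  have hin : (univ.filter fun i : Fin n =>
      (i.val < h ∧ windowGlue a ℓ z w i = true) ∧ (a ≤ i.val ∧ i.val < a + ℓ)).card = 0 := by
    rw [Finset.card_eq_zero, Finset.filter_eq_empty_iff]
    intro i _ hi
    omega
  have hout : (univ.filter fun i : Fin n =>
      (i.val < h ∧ windowGlue a ℓ z w i = true) ∧ ¬ (a ≤ i.val ∧ i.val < a + ℓ)) =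
      univ.filter fun i : Fin n => (i.val < h ∧ z i = true) ∧ ¬ (a ≤ i.val ∧ i.val < a + ℓ) := by
    refine Finset.filter_congr fun i _ => ?_
    constructor
    · rintro ⟨⟨hi, hg⟩, hb⟩
      simp only [windowGlue, dif_neg hb] at hg
      exact ⟨⟨hi, hg⟩, hb⟩
    · rintro ⟨⟨hi, hz⟩, hb⟩
      refine ⟨⟨hi, ?_⟩, hb⟩
      simp only [windowGlue, dif_neg hb]
      exact hz
  rw [hin, hout] at hsplit
  unfold wtPrefix outP at *
  omega

/-- Prefix weight of a glued input at a cut `h ≥ a + ℓ` (window entirely in the prefix): outside part plus the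
window weight. -/
theorem wtPrefix_windowGlue_of_ge (a ℓ : ℕ) (ha : a + ℓ ≤ n) (z : Fin n → Bool) (w : Fin ℓ → Bool) {h : ℕ}
    (hh : a + ℓ ≤ h) : wtPrefix (windowGlue a ℓ z w) h = outP a ℓ z h + wt w := by
  have hsplit := Finset.card_filter_add_card_filter_not
    (s := univ.filter fun i : Fin n => i.val < h ∧ windowGlue a ℓ z w i = true)
    (fun i : Fin n => a ≤ i.val ∧ i.val < a + ℓ)
  rw [Finset.filter_filter, Finset.filter_filter] at hsplit
  have hin : (univ.filter fun i : Fin n =>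
      (i.val < h ∧ windowGlue a ℓ z w i = true) ∧ (a ≤ i.val ∧ i.val < a + ℓ)) =
      univ.filter fun i : Fin n => windowGlue a ℓ z w i = true ∧ (a ≤ i.val ∧ i.val < a + ℓ) := by
    refine Finset.filter_congr fun i _ => ?_
    constructor
    · rintro ⟨⟨_, hg⟩, hb⟩
      exact ⟨hg, hb⟩
    · rintro ⟨hg, hb⟩
      exact ⟨⟨by omega, hg⟩, hb⟩
  have hout : (univ.filter fun i : Fin n =>
      (i.val < h ∧ windowGlue a ℓ z w i = true) ∧ ¬ (a ≤ i.val ∧ i.val < a + ℓ)) =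
      univ.filter fun i : Fin n => (i.val < h ∧ z i = true) ∧ ¬ (a ≤ i.val ∧ i.val < a + ℓ) := by
    refine Finset.filter_congr fun i _ => ?_
    constructor
    · rintro ⟨⟨hi, hg⟩, hb⟩
      simp only [windowGlue, dif_neg hb] at hg
      exact ⟨⟨hi, hg⟩, hb⟩
    · rintro ⟨⟨hi, hz⟩, hb⟩
      refine ⟨⟨hi, ?_⟩, hb⟩
      simp only [windowGlue, dif_neg hb]
      exact hz
  rw [hin, card_windowGlue_window a ℓ ha z w, hout] at hsplit
  unfold wtPrefix outP at *
  omega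

end Glue

/-! ### §4 The three parities along a gap -/

section Parities

variable {n : ℕ}

/-- The slice constant `q_h = c + h + (outside weight) + (outside prefix weight before h)`. -/
def sliceConst (c a ℓ : ℕ) (z : Fin n → Bool) (h : ℕ) : ℕ := c + h + outW a ℓ z + outP a ℓ z h

/-- The UNIQUE window weight class `b ∈ {0,1,2}` at which the cut `h` is dead in the slice of `z`:
`-q_h` for a cut before the window, `q_h` (the solution of `q_h + 2b ≡ 0`) for a cut after it. -/
def deadClass (c a ℓ : ℕ) (z : Fin n → Bool) (h : ℕ) : ℕ :=
  if h ≤ a then (3 - sliceConst c a ℓ z h % 3) % 3 else sliceConst c a ℓ z h % 3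

/-- `deadClass < 3`. -/
theorem deadClass_lt (c a ℓ : ℕ) (z : Fin n → Bool) (h : ℕ) : deadClass c a ℓ z h < 3 := by
  unfold deadClass
  split <;> omega

/-- **Liveness in a slice.** For a cut not separating the window, `h` is live at `glue a ℓ z w` iff the
window weight class `|w| mod 3` differs from `deadClass … h`. -/
theorem live_windowGlue_iff (c a ℓ : ℕ) (hℓ : 0 < ℓ) (ha : a + ℓ ≤ n) (z : Fin n → Bool) (w : Fin ℓ → Bool)
    {h : ℕ} (hgap : h ≤ a ∨ a + ℓ ≤ h) :
    (c + h + walkExp (windowGlue a ℓ z w) h) % 3 ≠ 0 ↔ wt w % 3 ≠ deadClass c a ℓ z h := by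
  unfold walkExp deadClass sliceConst
  rw [wt_windowGlue a ℓ ha z w]
  rcases hgap with hle | hge
  · rw [wtPrefix_windowGlue_of_le a ℓ z w hle, if_pos hle]
    omega
  · have hna : ¬ h ≤ a := by omega
    rw [wtPrefix_windowGlue_of_ge a ℓ ha z w hge, if_neg hna]
    omega

/-- **Three parities along a gap** (pure counting): if every `h ∈ Y` is assigned a class `bd h ∈ {0,1,2}`, then for
some class `b ∈ {0,1,2}` the number of `h ∈ Y` with `bd h ≠ b` is EVEN (the three counts sum to `2·#Y`). -/
theorem exists_even_class (Y : Finset (Fin (n + 1))) (bd : Fin (n + 1) → ℕ) (hbd : ∀ h ∈ Y, bd h < 3) :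
    ∃ b, b < 3 ∧ (Y.filter fun h => bd h ≠ b).card % 2 = 0 := by
  have hfib : Y.card = ∑ b ∈ range 3, (Y.filter fun h => bd h = b).card :=
    Finset.card_eq_sum_card_fiberwise fun h hh => Finset.mem_coe.2 (Finset.mem_range.2 (hbd h hh))
  have hsplit : ∀ b : ℕ, (Y.filter fun h => bd h = b).card + (Y.filter fun h => bd h ≠ b).card = Y.card :=
    fun b => Finset.card_filter_add_card_filter_not (fun h => bd h = b)
  rw [Finset.sum_range_succ, Finset.sum_range_succ, Finset.sum_range_succ, Finset.sum_range_zero,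
    zero_add] at hfib
  by_contra hall
  push Not at hall
  have a0 := hall 0 (by norm_num)
  have a1 := hall 1 (by norm_num)
  have a2 := hall 2 (by norm_num)
  have s0 := hsplit 0
  have s1 := hsplit 1
  have s2 := hsplit 2
  omega

/-- In every slice some window weight class consists of LOSSES of the gapped fixed set `Y`. -/
theorem exists_losing_windowClass (c a ℓ : ℕ) (hℓ : 0 < ℓ) (ha : a + ℓ ≤ n) (Y : Finset (Fin (n + 1)))
    (hgap : ∀ h ∈ Y, h.val ≤ a ∨ a + ℓ ≤ h.val) (z : Fin n → Bool) :
    ∃ b, b < 3 ∧ ∀ w : Fin ℓ → Bool, wt w % 3 = b → winY c Y (windowGlue a ℓ z w) = false := by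
  obtain ⟨b, hb3, hbeven⟩ :=
    exists_even_class Y (fun h => deadClass c a ℓ z h.val) (fun h _ => deadClass_lt c a ℓ z h.val)
  refine ⟨b, hb3, fun w hw => ?_⟩
  have hcount : liveCountY c Y (windowGlue a ℓ z w) = (Y.filter fun h => deadClass c a ℓ z h.val ≠ b).card := by
    unfold liveCountY
    congr 1
    refine Finset.filter_congr fun h hh => ?_
    rw [live_windowGlue_iff c a ℓ hℓ ha z w (hgap h hh), hw]
    exact ne_comm
  unfold winY
  rw [decide_eq_false_iff_not, hcount]
  omega

end Parities

end Summit.QuantumAdvantage.QuantumAdvantage.Theorems.GapLaw
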